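import Summits.BirchSwinnertonDyer.BirchSwinnertonDyer.Theorems.SmallImageMuTransferMuTransferX9TwistFixedAbelian
import Literature.NumberTheory.GaloisRepresentations.AbsGaloisGroupCompact
import HarnessLib

/-!
# K6 crux `MuTransferX9` (stmt-BirchSwinnertonDyer-19276), skeleton v6 stub `stub_stepsTwoFourOdd`:
# the INSTANCE and `hfix` binders of the local `q`-files, discharged at the stub's binders
# (`LocallyCompactSpace Γ_{ℚ_q}` in both spellings of the completion; `E[p]^{Gal(ℚ̄/ℚ(μ_ℓ))} = 0`)

Cell `b2b-bsdres` (X9 prover lineage, GEN 45) serving the K6 route `SmallImageMuTransfer` of cell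
`bsd-smallim`.  HONEST FRAMING: the cell deletes COMBINATION-SHAPED residual classes of the rank-≤1
BSD formula from PUBLISHED theorems only and TYPES the construction-shaped remainder; this is not
"finishing BSD"; class X9 stays TYPED at class level.  `--supports` helper toward
stmt-BirchSwinnertonDyer-19276 (`stub_stepsTwoFourOdd`, skeleton v6 `a90a661b046bb403` / v6d); books
nothing, closes nothing; THEOREMS ONLY (no definition, no instance declaration, no named fact, no `sorry`).

## Why / What

koly's STEP 4 (`LocalSplitPrime.convCoeff_eq_zero_of_transverse_of_unramified`, p457656) is stated
under the section instances `[LocallyCompactSpace (absoluteGaloisGroup K)]` and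
`[LocallyCompactSpace (absoluteGaloisGroup (Place.Completion (Sum.inr q : Place K)))]`, and the
Kolyvagin package (k6-g3 p454778 / x10 p469014 / x9 p469046) under
`hfix : ∀ m : M, (∀ g ∈ rootsOfUnityFixer ℚ ℓ, ρ g m = m) → m = 0`.  The registered stub carries none
of these.  Over `ℚ` the first instance is found by instance search (`CharZero ℚ`); the LOCAL one is
NOT (`q.adicCompletion ℚ` has no `CharZero` instance in scope, and the `Place.Completion` spelling is
a further syntactic key) — it follows from the tree's `absoluteGaloisGroup_compactSpace` (any field).
`hfix` at `M = E[p]` is "`E(ℚ(μ_ℓ))[p] = 0`" for `p` odd and `E[p]` irreducible (b2b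
`geomTorsion_eq_zero_of_fixed_of_commutator_le` + `commutator_le_rootsOfUnityFixer`), in the
`DiscreteGaloisModule` spelling `W.torsionGaloisModule (p : ℤ) g m` of the package.

* `compactSpace_absoluteGaloisGroup_adicCompletion` / `…_placeCompletion`,
  `locallyCompactSpace_absoluteGaloisGroup_adicCompletion` / `…_placeCompletion` (any number field
  `K`, any finite place `v`; theorems to `haveI`, not instances).
* `torsionGaloisModule_eq_zero_of_forall_rootsOfUnityFixer_apply_eq` = `hfix` VERBATIM at
  `ρ := W.torsionGaloisModule (p : ℤ)`, `N := rootsOfUnityFixer ℚ ℓ`; and the commutator form.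

PARTITION (D-0054): X9 (A4) · X10b∧¬Surj (A5) at `p = 3` — seam helper toward `stub_stepsTwoFourOdd`;
closes NONE.

References: J. Neukirch, *Algebraic Number Theory* (1999) Ch. IV (1.1) (profinite = compact), Ch. II
(9.6) [NeukirchANT1999]; J.-P. Serre, Invent. Math. 15 (1972) §5.2 (iv), §5.4 [Serre1972];
L. Washington, *Cyclotomic Fields* §13.1 [Washington1997]; HOME/koly/MU-TRANSFER-PROOF.md (F1), §5 STEP 4.
-/

-- the summit and its single problem are both named `BirchSwinnertonDyer` (registry layout D-0017)
set_option linter.dupNamespace false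

set_option autoImplicit false

noncomputable section

open scoped NumberField
open Field IsDedekindDomain NumberField WeierstrassCurve
open Literature.NumberTheory.GaloisRepresentations
open Literature.NumberTheory.EllipticCurves

namespace Summit.BirchSwinnertonDyer.BirchSwinnertonDyer.Rank1Residual.TameSeams

/-! ## §1 Compactness of the local absolute Galois groups, in both spellings of the completion -/

section LocalCompact

variable (K : Type) [Field K] [NumberField K] (v : HeightOneSpectrum (𝓞 K))

/-- `Γ_{K_v}` is compact (`adicCompletion` spelling). [cite: NeukirchANT1999, Ch. IV (1.1)] -/
theorem compactSpace_absoluteGaloisGroup_adicCompletion :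
    CompactSpace (absoluteGaloisGroup (v.adicCompletion K)) :=
  absoluteGaloisGroup_compactSpace _

/-- `Γ_{K_v}` is compact (`Place.Completion (Sum.inr v)` spelling of koly's local sections; the two
types agree by `rfl`, but instance search keys on the spelling). [cite: NeukirchANT1999, Ch. IV (1.1)] -/
theorem compactSpace_absoluteGaloisGroup_placeCompletion :
    CompactSpace (absoluteGaloisGroup (Place.Completion (Sum.inr v : Place K))) :=
  absoluteGaloisGroup_compactSpace _

/-- **`Γ_{K_v}` is locally compact** (`adicCompletion` spelling) — the section instance of the local
`q`-files, as a theorem to `haveI`. [cite: NeukirchANT1999, Ch. IV (1.1)] -/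
theorem locallyCompactSpace_absoluteGaloisGroup_adicCompletion :
    LocallyCompactSpace (absoluteGaloisGroup (v.adicCompletion K)) := by
  haveI := compactSpace_absoluteGaloisGroup_adicCompletion K v
  infer_instance

/-- **`Γ_{K_v}` is locally compact** (`Place.Completion (Sum.inr v)` spelling) — the section instance
`[LocallyCompactSpace (absoluteGaloisGroup (Place.Completion (Sum.inr q : Place K)))]` of
`LocalSplitPrime.convCoeff_eq_zero_of_transverse_of_unramified`, as a theorem to `haveI`.
[cite: NeukirchANT1999, Ch. IV (1.1)] -/
theorem locallyCompactSpace_absoluteGaloisGroup_placeCompletion :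
    LocallyCompactSpace (absoluteGaloisGroup (Place.Completion (Sum.inr v : Place K))) := by
  haveI := compactSpace_absoluteGaloisGroup_placeCompletion K v
  infer_instance

end LocalCompact

/-! ## §2 `hfix` at `M = E[p]`: `E(ℚ(μ_ℓ))[p] = 0` in the `DiscreteGaloisModule` spelling -/

section Fix

variable (W : WeierstrassCurve ℚ) [W.IsElliptic] (p : ℕ) [Fact p.Prime]

/-- **`E[p]^U = 0` for `U ⊇ [Γ_ℚ, Γ_ℚ]`** (`p` odd, `E[p]` irreducible), in the spelling
`W.torsionGaloisModule (p : ℤ) g m` of the Kolyvagin package. [cite: Serre1972, §5.2 (iv) and §5.4] -/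
theorem torsionGaloisModule_eq_zero_of_forall_apply_eq_of_commutator_le (hp2 : p ≠ 2)
    (hirr : W.HasIrreducibleModPGaloisRep p) {U : Subgroup (absoluteGaloisGroup ℚ)}
    (hU : commutator (absoluteGaloisGroup ℚ) ≤ U) (m : geomTorsion W (p : ℤ))
    (hm : ∀ g ∈ U, W.torsionGaloisModule (p : ℤ) g m = m) : m = 0 :=
  Summit.BirchSwinnertonDyer.Rank1Residual.GaloisImage.geomTorsion_eq_zero_of_fixed_of_commutator_le
    W p hp2 hirr hU m fun σ hσ => by rw [← torsionGaloisModule_apply_apply]; exact hm σ hσ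

/-- **`hfix` VERBATIM at `ρ := W.torsionGaloisModule (p : ℤ)`, `N := Gal(ℚ̄/ℚ(μ_ℓ))`**: for `p` odd
and `E[p]` irreducible, a point of `E[p]` fixed by `rootsOfUnityFixer ℚ ℓ` is `0` (`ℚ(μ_ℓ)/ℚ` is
abelian: `commutator_le_rootsOfUnityFixer`).  Feeds k6-g3 `exists_kolyvaginCocycle_rat`, x10
`exists_kolyvaginCocycle_value`, x9 `exists_kolyvaginCocycle_meetingPoint_gen`.
[cite: Serre1972, §5.2 (iv) and §5.4] [cite: Washington1997, §13.1–§13.2] -/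
theorem torsionGaloisModule_eq_zero_of_forall_rootsOfUnityFixer_apply_eq (hp2 : p ≠ 2)
    (hirr : W.HasIrreducibleModPGaloisRep p) (ℓ : ℕ) [NeZero ℓ] :
    ∀ m : geomTorsion W (p : ℤ),
      (∀ g ∈ rootsOfUnityFixer ℚ ℓ, W.torsionGaloisModule (p : ℤ) g m = m) → m = 0 :=
  fun m hm => torsionGaloisModule_eq_zero_of_forall_apply_eq_of_commutator_le W p hp2 hirr
    (commutator_le_rootsOfUnityFixer ℚ ℓ) m hm

end Fix

end Summit.BirchSwinnertonDyer.BirchSwinnertonDyer.Rank1Residual.TameSeams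

end
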